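import Literature.AlgebraicGeometry.HodgeTheory.BlochSemiregularSpreadCells
import Literature.AlgebraicGeometry.HodgeTheory.LefschetzOneOneHolds
import HarnessLib

/-!
# Crux `HodgeAbelianVarieties` (stmt-HodgeConjecture-1333), line `prym-canonical-z3-split-seeds` — stub `stub_blochSpread`: the cells of Bloch's class-level semiregularity theorem that hold OUTRIGHT today

The registered stub of the line is the tree's NAMED FACT in full,
`stub_blochSpread : ∀ n p, Literature.AlgebraicGeometry.HodgeTheory.BlochSemiregularSpread n p`
(S. Bloch, Invent. Math. 17 (1972), Thm. (7.4)/(7.5); R.-O. Buchweitz, H. Flenner, Compositio 137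
(2003), Thm. 5.2 at `I = {p}`; file `Literature/AlgebraicGeometry/HodgeTheory/BlochSemiregularSpread`):
a Bloch-semiregular local complete intersection `Z ↪ X₀ ≅ 𝒳_{s₀}` of codimension `p` supporting the
value at `s₀` of a fibrewise rational `(p,p)` global class `W` of a smooth projective family
`f : 𝒳 ⟶ S` of relative dimension `n` forces `W|_{𝒳_t} ∈ algebraicClasses (𝒳_t) p` for `t` near `s₀`.
The composition of the line consumes ONLY the cell `(n, p) = (8, 4)`
(`prymSpread_of_seed_of_bloch`, file `…PrymSeedDefs`).

This helper file (registered sub-goal `blochSpread_cells_holds`, `--supports` the crux item) proves,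
with NO named fact taken as hypothesis, every cell of the stub that is a theorem of the tree today:

* `blochSpread_of_lefschetzRange` — the LEFSCHETZ RANGE `p ≤ 1 ∨ n ≤ p + 1` for every `n`: there the
  conclusion holds for every rational `(p,p)` class on every fibre, seed or no seed, by Lefschetz's
  theorem on `(1,1)`-classes (`lefschetzOneOne_rational_holds`, landed 2026-08-16) and hard Lefschetz
  (`nonempty_hardLefschetzNFold_holds`, `mem_algebraicClasses_of_lt_of_nonempty`: a rational
  `(p,p)`-class with `n < 2p` is `L^{2p-n}` of a rational `(n-p,n-p)`-class, algebraic for `n - p ≤ 1`);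
  this contains the degenerate cells `p = 0`, `p = n`, `n < p` of `BlochSemiregularSpreadCells`
  (p112702) and adds `p = 1` and `p = n - 1` unconditionally.
* `blochSpread_cells_holds` — the registered sub-goal: `p ≤ 1 ∨ n ≤ 3 ∨ n ≤ p + 1`, adding the
  threefold cell (`blochSemiregularSpread_of_dim_le_three` fed with
  `hodgeClasses_algebraic_of_dim_le_three_holds`).
* `stub_blochSpread_of_interior` — pure logic: the registered stub is EQUIVALENT to its interior cells
  `4 ≤ n`, `2 ≤ p ≤ n - 2` (the first one on an abelian variety being `(4, 2)`; the consumed one is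
  `(8, 4)`), which are Bloch's theorem proper (relative Hilbert scheme, `T²`, cycle classes of flat
  families — none of which the tree has on real carriers; module docstring of
  `BlochSemiregularSpread.lean`, "What is NOT here").

Nothing here touches the cell `(8, 4)`.

## References

* [Bloch1972Semiregularity] S. Bloch, Semi-regularity and de Rham cohomology, Invent. Math. 17 (1972),
  Thm. (7.4), Remark (7.5).
* [BuchweitzFlenner2003] R.-O. Buchweitz, H. Flenner, A semiregularity map for modules and applications
  to deformations, Compositio Math. 137 (2003), Thm. 5.2.
* [VoisinHodgeI2002] C. Voisin, Hodge Theory and Complex Algebraic Geometry I (2002), Thm. 6.25,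
  Rem. 6.27, §7.1.2, Thm. 11.30, Cor. 11.34.
* [VoisinHodgeII2003] C. Voisin, Hodge Theory and Complex Algebraic Geometry II (2003), §10.2.3, proof
  of Prop. 10.26.
* [KerrPearlstein2011] M. Kerr, G. Pearlstein, An exponential history of functions with logarithmic
  growth (2011), §3.1 (the Lefschetz range of the Hodge conjecture).
-/

-- every declaration of this problem lives in `Summit.HodgeConjecture.HodgeConjecture.…` (single-problem summit)
set_option linter.dupNamespace false

open Literature.AlgebraicGeometry.HodgeTheory Literature.AlgebraicGeometry.Motives

namespace Summit.HodgeConjecture.HodgeConjecture.Cruxes.HodgeAbelianVarieties.PrymCanonicalZ3SplitSeeds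

/-- **The Lefschetz range of Bloch's class-level theorem holds outright**: for `p ≤ 1` or
`n ≤ p + 1` (codimensions `0`, `1`, `n - 1`, `n` and `> n`), `BlochSemiregularSpread n p` is a theorem —
on every smooth projective `n`-fold every rational class of type `(p,p)` in these codimensions is
algebraic (`p = 0`: `algebraicClasses_zero`; `p = 1`: Lefschetz `(1,1)`, `lefschetzOneOne_rational_holds`;
`n < 2p` with `n - p ≤ 1`: hard Lefschetz transport `L^{2p-n}` from codimension `n - p`,
`mem_algebraicClasses_of_lt_of_nonempty` with `nonempty_hardLefschetzNFold_holds`), so the conclusion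
of the fact holds on all of `S(ℂ)` (`blochSemiregularSpread_of_forall_mem_algebraicClasses`), the
semiregular seed being unused.
[cite: VoisinHodgeI2002, Thm. 11.30 with Cor. 11.34; Thm. 6.25, Rem. 6.27 and §7.1.2]
[cite: KerrPearlstein2011, §3.1] -/
theorem blochSpread_of_lefschetzRange {n p : ℕ} (hp : p ≤ 1 ∨ n ≤ p + 1) :
    BlochSemiregularSpread n p := by
  refine blochSemiregularSpread_of_forall_mem_algebraicClasses fun X hX c hc hpp => ?_
  -- the codimensions `q ≤ 1` directly
  have low : ∀ q : ℕ, q ≤ 1 → ∀ c' : complexBetti X (2 * q), IsRationalClass c' →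
      IsOfHodgeType n X (2 * q) q q c' → c' ∈ algebraicClasses X q := by
    intro q hq c' hc' hqq
    interval_cases q
    · rw [algebraicClasses_zero]
      exact Submodule.mem_top
    · exact lefschetzOneOne_rational_holds hX c' hc' hqq
  by_cases h2 : n < 2 * p
  · -- hard Lefschetz from codimension `n - p ≤ 1`
    exact mem_algebraicClasses_of_lt_of_nonempty (nonempty_hardLefschetzNFold_holds n X) hX h2
      (low (n - p) (by omega)) c hc hpp
  · -- `2p ≤ n`, so `n ≤ p + 1` forces `p ≤ 1`
    exact low p (by omega) c hc hpp

/-- **Registered sub-goal `blochSpread_cells_holds`: every cell of `stub_blochSpread` that is a theorem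
of the tree today** — the Lefschetz range `p ≤ 1 ∨ n ≤ p + 1` (`blochSpread_of_lefschetzRange`) and
relative dimension `n ≤ 3` (the Hodge conjecture for curves, surfaces and threefolds,
`hodgeClasses_algebraic_of_dim_le_three_holds`, through `blochSemiregularSpread_of_dim_le_three`).
No named fact is taken as hypothesis.
[cite: VoisinHodgeI2002, Thm. 11.30, Thm. 6.25 and Rem. 6.27]
[cite: VoisinHodgeII2003, §10.2.3 proof of Prop. 10.26] -/
theorem blochSpread_cells_holds :
    ∀ n p : ℕ, (p ≤ 1 ∨ n ≤ 3 ∨ n ≤ p + 1) →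
      Literature.AlgebraicGeometry.HodgeTheory.BlochSemiregularSpread n p := by
  rintro n p (hp | hn | hnp)
  · exact blochSpread_of_lefschetzRange (Or.inl hp)
  · exact blochSemiregularSpread_of_dim_le_three hodgeClasses_algebraic_of_dim_le_three_holds hn p
  · exact blochSpread_of_lefschetzRange (Or.inr hnp)

/-- **What is left of the stub** (pure logic over `blochSpread_cells_holds`): the registered
`stub_blochSpread : ∀ n p, BlochSemiregularSpread n p` follows from — hence is equivalent to — its
INTERIOR cells `4 ≤ n`, `2 ≤ p`, `p + 2 ≤ n`, i.e. Bloch's theorem in the codimensions where the Hodge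
conjecture is not known (the line consumes `(n, p) = (8, 4)` only). Recorded so that a reshape of the
stub to the single consumed cell, or to the interior family, is a one-line step.
[cite: Bloch1972Semiregularity, Thm. (7.4) and Remark (7.5)] [cite: BuchweitzFlenner2003, Thm. 5.2] -/
theorem stub_blochSpread_of_interior
    (h : ∀ n p : ℕ, 4 ≤ n → 2 ≤ p → p + 2 ≤ n → BlochSemiregularSpread n p) :
    ∀ n p : ℕ, BlochSemiregularSpread n p := by
  intro n p
  by_cases hc : p ≤ 1 ∨ n ≤ 3 ∨ n ≤ p + 1
  · exact blochSpread_cells_holds n p hc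
  · simp only [not_or, not_le] at hc
    exact h n p (by omega) (by omega) (by omega)

/-- The consumed cell in the interior form: `BlochSemiregularSpread 8 4` is the instance
`(n, p) = (8, 4)` of the interior family (so a proof of the interior family, or of this single cell,
is all the line's composition `prymSpread_of_seed_of_bloch` needs). [folklore] -/
theorem blochSpread_eight_four_of_interior
    (h : ∀ n p : ℕ, 4 ≤ n → 2 ≤ p → p + 2 ≤ n → BlochSemiregularSpread n p) :
    BlochSemiregularSpread 8 4 :=
  h 8 4 (by norm_num) (by norm_num) (by norm_num)

end Summit.HodgeConjecture.HodgeConjecture.Cruxes.HodgeAbelianVarieties.PrymCanonicalZ3SplitSeeds
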